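import Summits.QuantumFields.YangMills.Theorems.PoincareLipschitzCovariantCaccioppoli
import Summits.QuantumFields.YangMills.Theorems.PoincareLipschitzDirichletSupOfEnergy
import HarnessLib

/-!
# Line «poincare_lipschitz» on crux `HistoryTailL` (stmt-QuantumFields-19936), route crux `BlockLipschitzL` (stmt-QuantumFields-23533), K2 supplier plan,
# (R3)-COV brick (b-corrector) — THE `L^∞` BOUND FOR THE COVARIANT BOX DIRICHLET CORRECTOR WITH DIVERGENCE-FORM DATA, GENUINELY COVARIANT:
# `w = 0` off `Q_r(z₀)`, `(Σ_μ D*_μD_μ + κ)w = Σ_μ D*_μ g_μ` on `Q_r(z₀)` (`κ ≥ 0`), `‖g_μ‖ ≤ m` ⟹ `‖w(y)‖ ≤ 64·2^d·d·m·(2r+1)` — the FLAT constant of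
# ✓`Prop7FlatDirichletSup.abs_le_of_dirichlet`, for ANY connection by linear isometries (vector truncation `w − P_{B(0,k)}w` + De Giorgi on `‖w‖`)

Cell `ym3-torus` (YM ladder rung R3 = continuum SU(2) Yang–Mills on the three-torus — a RUNG, NOT the Clay problem: not d = 4, not infinite volume, not a
mass gap); width seat `ym3-torus-px7` gen 4 («COV-DIRICHLET-SUP», bus 2026-08-29T01:24Z; LEAD ym-ust-19936-w1 g7's covariant road, card v1.29; the Dirichlet
EXISTENCE∕replacement half is ★w5-19936 g11's «COV-DIRICHLET»).  THEOREMS ONLY (def-free); the letters of ✓`PoincareLipschitzCovariantCaccioppoli` (p685881):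
`V` a real inner-product space, `τ : Fin d → ℤ^d → (V ≃ₗᵢ[ℝ] V)`, `D_μu(y) = τ μ y (u(y+e_μ)) − u(y)`, `D*_μG(y) = (τ μ (y−e_μ))⁻¹(G(y−e_μ)) − G(y)`;
`--supports stmt-QuantumFields-23533`.  Nothing here proves the (R3)-COV row, `hStab`, F5/F6, a stub, `BlockLipschitzL`, `HistoryTailL` or a summit statement.

THE POINT.  The flat sup bound tests `−Δw = ∂*g` with the scalar truncations `(w−k)₊`.  For vector-valued `w` and a covariant Laplacian the right test
function is the VECTOR truncation `T_k w := (1 − k/‖w‖)₊ • w = w − P_{B(0,k)} w` (radial projection onto the closed ball of radius `k`): (i) it commutes with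
every linear isometry (`T_k(τa) = τ(T_k a)`), (ii) `I − P_C` is FIRMLY NON-EXPANSIVE (`‖T_ka − T_kb‖² ≤ ⟪T_ka − T_kb, a − b⟫`, from the variational inequality
of the projection), (iii) `‖T_k a‖ = (‖a‖ − k)₊` so `|(‖a‖−k)₊ − (‖b‖−k)₊| ≤ ‖T_ka − T_kb‖`.  Hence the SCALAR `z := ‖w‖` obeys the flat truncation-energy
inequality `Σ|∇(z−k)₊|² ≤ 2d·m²·#{z > k}` (§2), and the energy-form De Giorgi iteration ✓`PoincareLipschitzDirichletSupOfEnergy.le_of_energy` gives the bound (§3)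
— with the FLAT constant and NO hypothesis on the connection.

* §1 `norm_radialTrunc`, `radialTrunc_isometry`, `inner_radialTrunc_le` (variational inequality), ★ `normSq_sub_le_inner_sub` (firm non-expansiveness),
  `abs_posPart_sub_le`, `inner_le_half_normSq_add` (vector Young with an indicator).
* §2 ★ `cov_truncation_energy_le` — the covariant twin of ✓`Prop7FlatDirichletSup.truncation_energy_le` for `z = ‖w‖`.
* §3 ★★ `norm_le_of_covDirichlet` — the title.
[folklore] (De Giorgi 1957 ∕ Stampacchia truncation; firm non-expansiveness of metric projections; [Giaquinta1984] Ch. III §2 as method pointer;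
[Balaban1984PropagatorsII] (1.9) p.226 the print locus of the flat constants).
-/

set_option autoImplicit false

noncomputable section

open scoped BigOperators InnerProductSpace
open Finset

namespace Summit.QuantumFields.YangMills.Theorems.PoincareLipschitzCovariantDirichletSup

open Literature.MathematicalPhysics.QuantumFieldTheory.Balaban1983to89
open B4Eq19LatticeOperators
open Summit.QuantumFields.YangMills.Theorems.PoincareLipschitzCovariantCaccioppoli (sum_inner_covLop sum_inner_covDvg)
open Summit.QuantumFields.YangMills.Theorems.PoincareLipschitzDirichletSupOfEnergy (le_of_energy)

variable {V : Type*} [NormedAddCommGroup V] [InnerProductSpace ℝ V]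

/-! ## §1 The radial truncation `T_k a = (1 − k/‖a‖)₊ • a` -/

section Trunc

omit [InnerProductSpace ℝ V] in
/-- The coefficient `(1 − k/‖a‖)₊` lies in `[0, 1]` for `k ≥ 0`. [folklore] -/
theorem coeff_bounds {k : ℝ} (hk : 0 ≤ k) (a : V) : 0 ≤ max (1 - k / ‖a‖) 0 ∧ max (1 - k / ‖a‖) 0 ≤ 1 := by
  refine ⟨le_max_right _ _, max_le ?_ zero_le_one⟩
  have : 0 ≤ k / ‖a‖ := div_nonneg hk (norm_nonneg _)
  linarith

/-- `‖T_k a‖ = (‖a‖ − k)₊` for `k ≥ 0`. [folklore] -/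
theorem norm_radialTrunc {k : ℝ} (hk : 0 ≤ k) (a : V) : ‖(max (1 - k / ‖a‖) 0) • a‖ = max (‖a‖ - k) 0 := by
  rw [norm_smul, Real.norm_of_nonneg (coeff_bounds hk a).1]
  by_cases ha : a = 0
  · subst ha
    simp only [norm_zero, mul_zero, zero_sub]
    exact (max_eq_right (neg_nonpos.mpr hk)).symm
  · have hpos : 0 < ‖a‖ := norm_pos_iff.mpr ha
    by_cases hle : ‖a‖ ≤ k
    · have h1 : 1 - k / ‖a‖ ≤ 0 := by rw [sub_nonpos, le_div_iff₀ hpos, one_mul]; exact hle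
      rw [max_eq_right h1, zero_mul, max_eq_right (by linarith)]
    · push Not at hle
      have h1 : 0 ≤ 1 - k / ‖a‖ := by rw [sub_nonneg, div_le_iff₀ hpos, one_mul]; exact hle.le
      rw [max_eq_left h1, max_eq_left (by linarith), sub_mul, one_mul, div_mul_cancel₀ _ hpos.ne']

/-- **`T_k` commutes with linear isometries**: `τ (T_k a) = T_k (τ a)`. [folklore] -/
theorem radialTrunc_isometry (k : ℝ) (τ : V ≃ₗᵢ[ℝ] V) (a : V) :
    τ ((max (1 - k / ‖a‖) 0) • a) = (max (1 - k / ‖τ a‖) 0) • τ a := by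
  rw [LinearIsometryEquiv.map_smul, LinearIsometryEquiv.norm_map]

/-- **The variational inequality of the radial projection**: for `‖c‖ ≤ k` (`k ≥ 0`), `⟪T_k a, c⟫ ≤ ⟪T_k a, a − T_k a⟫` (the retained part `a − T_k a`
is the nearest point of the ball). [folklore] -/
theorem inner_radialTrunc_le {k : ℝ} (hk : 0 ≤ k) (a c : V) (hc : ‖c‖ ≤ k) :
    ⟪(max (1 - k / ‖a‖) 0) • a, c⟫_ℝ ≤ ⟪(max (1 - k / ‖a‖) 0) • a, a - (max (1 - k / ‖a‖) 0) • a⟫_ℝ := by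
  set lam : ℝ := max (1 - k / ‖a‖) 0 with hlam
  have hl0 : 0 ≤ lam := (coeff_bounds hk a).1
  rw [real_inner_smul_left, real_inner_smul_left, inner_sub_right, real_inner_smul_right, real_inner_self_eq_norm_sq]
  by_cases ha : a = 0
  · subst ha; simp
  · have hpos : 0 < ‖a‖ := norm_pos_iff.mpr ha
    by_cases hle : ‖a‖ ≤ k
    · have h1 : 1 - k / ‖a‖ ≤ 0 := by rw [sub_nonpos, le_div_iff₀ hpos, one_mul]; exact hle
      have : lam = 0 := by rw [hlam, max_eq_right h1]
      rw [this]; simp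
    · push Not at hle
      have h1 : 0 ≤ 1 - k / ‖a‖ := by rw [sub_nonneg, div_le_iff₀ hpos, one_mul]; exact hle.le
      have hlam' : lam = 1 - k / ‖a‖ := by rw [hlam, max_eq_left h1]
      -- `⟪a, c⟫ ≤ ‖a‖·k = ‖a‖² − lam‖a‖²`
      have hac : ⟪a, c⟫_ℝ ≤ ‖a‖ * k := (real_inner_le_norm _ _).trans (mul_le_mul_of_nonneg_left hc (norm_nonneg _))
      have hkey : ‖a‖ * k = ‖a‖ ^ 2 - lam * ‖a‖ ^ 2 := by rw [hlam']; field_simp; ring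
      rw [hkey] at hac
      exact mul_le_mul_of_nonneg_left hac hl0

/-- ★ **FIRM NON-EXPANSIVENESS of `T_k = I − P_{B(0,k)}`**: `‖T_ka − T_kb‖² ≤ ⟪T_ka − T_kb, a − b⟫` (`k ≥ 0`). [folklore] -/
theorem normSq_sub_le_inner_sub {k : ℝ} (hk : 0 ≤ k) (a b : V) :
    ‖(max (1 - k / ‖a‖) 0) • a - (max (1 - k / ‖b‖) 0) • b‖ ^ 2 ≤
      ⟪(max (1 - k / ‖a‖) 0) • a - (max (1 - k / ‖b‖) 0) • b, a - b⟫_ℝ := by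
  set Ta : V := (max (1 - k / ‖a‖) 0) • a with hTa
  set Tb : V := (max (1 - k / ‖b‖) 0) • b with hTb
  -- the retained parts are in the ball
  have hPa : ‖a - Ta‖ ≤ k := by
    have e : a - Ta = (1 - max (1 - k / ‖a‖) 0) • a := by rw [hTa, sub_smul, one_smul]
    rw [e, norm_smul]
    by_cases ha : a = 0
    · subst ha; simp [hk]
    · have hpos : 0 < ‖a‖ := norm_pos_iff.mpr ha
      by_cases hle : ‖a‖ ≤ k
      · have h1 : 1 - k / ‖a‖ ≤ 0 := by rw [sub_nonpos, le_div_iff₀ hpos, one_mul]; exact hle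
        rw [max_eq_right h1, sub_zero, Real.norm_of_nonneg zero_le_one, one_mul]; exact hle
      · push Not at hle
        have h1 : 0 ≤ 1 - k / ‖a‖ := by rw [sub_nonneg, div_le_iff₀ hpos, one_mul]; exact hle.le
        rw [max_eq_left h1, sub_sub_cancel, Real.norm_of_nonneg (div_nonneg hk hpos.le)]
        rw [div_mul_cancel₀ _ hpos.ne']
  have hPb : ‖b - Tb‖ ≤ k := by
    have e : b - Tb = (1 - max (1 - k / ‖b‖) 0) • b := by rw [hTb, sub_smul, one_smul]
    rw [e, norm_smul]
    by_cases hb : b = 0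
    · subst hb; simp [hk]
    · have hpos : 0 < ‖b‖ := norm_pos_iff.mpr hb
      by_cases hle : ‖b‖ ≤ k
      · have h1 : 1 - k / ‖b‖ ≤ 0 := by rw [sub_nonpos, le_div_iff₀ hpos, one_mul]; exact hle
        rw [max_eq_right h1, sub_zero, Real.norm_of_nonneg zero_le_one, one_mul]; exact hle
      · push Not at hle
        have h1 : 0 ≤ 1 - k / ‖b‖ := by rw [sub_nonneg, div_le_iff₀ hpos, one_mul]; exact hle.le
        rw [max_eq_left h1, sub_sub_cancel, Real.norm_of_nonneg (div_nonneg hk hpos.le)]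
        rw [div_mul_cancel₀ _ hpos.ne']
  -- the two variational inequalities
  have v1 : ⟪Ta, b - Tb⟫_ℝ ≤ ⟪Ta, a - Ta⟫_ℝ := inner_radialTrunc_le hk a (b - Tb) hPb
  have v2 : ⟪Tb, a - Ta⟫_ℝ ≤ ⟪Tb, b - Tb⟫_ℝ := inner_radialTrunc_le hk b (a - Ta) hPa
  -- `⟪Ta − Tb, a − b⟫ − ‖Ta − Tb‖² = ⟪Ta − Tb, (a − Ta) − (b − Tb)⟫ ≥ 0`
  have e : ⟪Ta - Tb, a - b⟫_ℝ - ‖Ta - Tb‖ ^ 2 = (⟪Ta, a - Ta⟫_ℝ - ⟪Ta, b - Tb⟫_ℝ) + (⟪Tb, b - Tb⟫_ℝ - ⟪Tb, a - Ta⟫_ℝ) := by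
    rw [← real_inner_self_eq_norm_sq]
    simp only [inner_sub_left, inner_sub_right, real_inner_comm Tb Ta]
    ring
  linarith [e]

/-- `|(‖a‖−k)₊ − (‖b‖−k)₊| ≤ ‖T_ka − T_kb‖` (reverse triangle inequality and `‖T_k·‖ = (‖·‖−k)₊`). [folklore] -/
theorem abs_posPart_sub_le {k : ℝ} (hk : 0 ≤ k) (a b : V) :
    |max (‖a‖ - k) 0 - max (‖b‖ - k) 0| ≤ ‖(max (1 - k / ‖a‖) 0) • a - (max (1 - k / ‖b‖) 0) • b‖ := by
  rw [← norm_radialTrunc hk a, ← norm_radialTrunc hk b]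
  exact abs_norm_sub_norm_le _ _

open Classical in
/-- Vector Young with an indicator: `‖b‖ ≤ m ⇒ ⟪a, b⟫ ≤ ½‖a‖² + ½m²·[a ≠ 0]`. [folklore] -/
theorem inner_le_half_normSq_add (a b : V) {m : ℝ} (hb : ‖b‖ ≤ m) :
    ⟪a, b⟫_ℝ ≤ (1 / 2) * ‖a‖ ^ 2 + (1 / 2) * m ^ 2 * (if a ≠ 0 then (1 : ℝ) else 0) := by
  by_cases ha : a ≠ 0
  · rw [if_pos ha, mul_one]
    have h1 : ⟪a, b⟫_ℝ ≤ ‖a‖ * ‖b‖ := real_inner_le_norm _ _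
    have hm : 0 ≤ m := (norm_nonneg _).trans hb
    have h2 : ‖a‖ * ‖b‖ ≤ ‖a‖ * m := mul_le_mul_of_nonneg_left hb (norm_nonneg _)
    nlinarith [sq_nonneg (‖a‖ - m)]
  · push Not at ha
    rw [ha]; simp

end Trunc

/-! ## §2 ★ The covariant truncation energy for `z = ‖w‖` -/

variable {d : ℕ}

/-- ★ **COVARIANT CACCIOPPOLI-ON-LEVEL-SETS for the Dirichlet corrector, read on `z = ‖w‖`.**  `w = 0` off `Q_r(z₀)`,
`(Σ_μ D*_μD_μ + κ)w = Σ_μ D*_μ g_μ` on `Q_r(z₀)` (`κ ≥ 0`), `‖g_μ(y)‖ ≤ m` for `y ∈ Q_{r+1}(z₀)`, `k ≥ 0`; then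
`Σ_{Q_{r+1}(z₀)} Σ_μ (∂_μ(‖w‖−k)₊)² ≤ 2d·m²·#{y ∈ Q_r(z₀) : ‖w(y)‖ > k}` (test with `T_k w`; §1; every bond carrying a non-zero `D_μ(T_k w)` has an end in the
super-level set). [folklore] [cite: Giaquinta1984, Ch. III §2 (2.3) p.77] -/
theorem cov_truncation_energy_le (τ : Fin d → Zd d → (V ≃ₗᵢ[ℝ] V)) {κ : ℝ} (hκ : 0 ≤ κ) {w : Zd d → V} {z₀ : Zd d} {r : ℤ}
    (g : Zd d → Fin d → V) {m k : ℝ} (hk : 0 ≤ k) (hw0 : ∀ y ∉ box z₀ r, w y = 0)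
    (hw : ∀ y ∈ box z₀ r, (∑ μ, ((w y + w y) - (τ μ (y - unitVec μ)).symm (w (y - unitVec μ)) - τ μ y (w (y + unitVec μ)))) + κ • w y =
      ∑ μ, ((τ μ (y - unitVec μ)).symm (g (y - unitVec μ) μ) - g y μ))
    (hg : ∀ y ∈ box z₀ (r + 1), ∀ μ, ‖g y μ‖ ≤ m) :
    ∑ y ∈ box z₀ (r + 1), ∑ μ, fdiff μ (fun x => max (‖w x‖ - k) 0) y ^ 2 ≤
      2 * d * m ^ 2 * (((box z₀ r).filter fun y => k < ‖w y‖).card : ℝ) := by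
  classical
  set φ : Zd d → V := fun x => (max (1 - k / ‖w x‖) 0) • w x with hφ
  set A := (box z₀ r).filter fun y => k < ‖w y‖ with hA
  have hφ0 : ∀ y ∉ box z₀ r, φ y = 0 := fun y hy => by simp only [hφ, hw0 y hy, smul_zero]
  have hφ0' : ∀ y ∉ box z₀ (r + 1 - 1), φ y = 0 := fun y hy => hφ0 y (by simpa using hy)
  -- where `φ ≠ 0`
  have hφA : ∀ y, φ y ≠ 0 → y ∈ A := by
    intro y hy
    have hyb : y ∈ box z₀ r := by
      by_contra h
      exact hy (hφ0 y h)
    rw [hA, Finset.mem_filter]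
    refine ⟨hyb, ?_⟩
    by_contra hle
    push Not at hle
    apply hy
    have : ‖φ y‖ = 0 := by rw [hφ]; simp only; rw [norm_radialTrunc hk, max_eq_right (by linarith)]
    exact norm_eq_zero.mp this
  -- the covariant difference of the test function and its energy
  set Dφ : Zd d → Fin d → V := fun y μ => τ μ y (φ (y + unitVec μ)) - φ y with hDφ
  set E : ℝ := ∑ y ∈ box z₀ (r + 1), ∑ μ, ‖Dφ y μ‖ ^ 2 with hE
  -- (0) the scalar energy is below the vector one, bond by bond
  have h0 : ∑ y ∈ box z₀ (r + 1), ∑ μ, fdiff μ (fun x => max (‖w x‖ - k) 0) y ^ 2 ≤ E := by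
    refine Finset.sum_le_sum fun y _ => Finset.sum_le_sum fun μ _ => ?_
    simp only [fdiff_apply, hDφ, hφ]
    have h := abs_posPart_sub_le hk (τ μ y (w (y + unitVec μ))) (w y)
    rw [← radialTrunc_isometry] at h
    rw [LinearIsometryEquiv.norm_map] at h
    calc (max (‖w (y + unitVec μ)‖ - k) 0 - max (‖w y‖ - k) 0) ^ 2
        = |max (‖w (y + unitVec μ)‖ - k) 0 - max (‖w y‖ - k) 0| ^ 2 := (sq_abs _).symm
      _ ≤ _ := pow_le_pow_left₀ (abs_nonneg _) h 2
  -- (1) firm non-expansiveness: `E ≤ Σ ⟪Dφ, Dw⟫`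
  have h1 : E ≤ ∑ y ∈ box z₀ (r + 1), ∑ μ, ⟪Dφ y μ, τ μ y (w (y + unitVec μ)) - w y⟫_ℝ := by
    refine Finset.sum_le_sum fun y _ => Finset.sum_le_sum fun μ _ => ?_
    simp only [hDφ, hφ]
    have h := normSq_sub_le_inner_sub hk (τ μ y (w (y + unitVec μ))) (w y)
    rw [← radialTrunc_isometry] at h
    exact h
  -- (2) the Dirichlet form (+ the non-negative mass term) is `Σ ⟪φ, (D*D + κ) w⟫`
  have h2 : ∑ y ∈ box z₀ (r + 1), ∑ μ, ⟪Dφ y μ, τ μ y (w (y + unitVec μ)) - w y⟫_ℝ + κ * ∑ y ∈ box z₀ (r + 1), ⟪φ y, w y⟫_ℝ =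
      ∑ y ∈ box z₀ (r + 1), ⟪φ y, (∑ μ, ((w y + w y) - (τ μ (y - unitVec μ)).symm (w (y - unitVec μ)) - τ μ y (w (y + unitVec μ)))) + κ • w y⟫_ℝ := by
    rw [sum_inner_covLop τ κ φ w z₀ (r + 1) hφ0']
  have hmass : 0 ≤ κ * ∑ y ∈ box z₀ (r + 1), ⟪φ y, w y⟫_ℝ := by
    apply mul_nonneg hκ
    refine Finset.sum_nonneg fun y _ => ?_
    simp only [hφ, real_inner_smul_left, real_inner_self_eq_norm_sq]
    exact mul_nonneg (coeff_bounds hk (w y)).1 (sq_nonneg _)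
  -- (3) the equation, where `φ` lives
  have h3 : ∑ y ∈ box z₀ (r + 1), ⟪φ y, (∑ μ, ((w y + w y) - (τ μ (y - unitVec μ)).symm (w (y - unitVec μ)) - τ μ y (w (y + unitVec μ)))) + κ • w y⟫_ℝ =
      ∑ y ∈ box z₀ (r + 1), ⟪φ y, ∑ μ, ((τ μ (y - unitVec μ)).symm (g (y - unitVec μ) μ) - g y μ)⟫_ℝ := by
    refine Finset.sum_congr rfl fun y _ => ?_
    by_cases hy : y ∈ box z₀ r
    · rw [hw y hy]
    · rw [hφ0 y hy, inner_zero_left, inner_zero_left]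
  -- (4) summation by parts for the adjoint
  have h4 : ∑ y ∈ box z₀ (r + 1), ⟪φ y, ∑ μ, ((τ μ (y - unitVec μ)).symm (g (y - unitVec μ) μ) - g y μ)⟫_ℝ =
      ∑ y ∈ box z₀ (r + 1), ∑ μ, ⟪Dφ y μ, g y μ⟫_ℝ := sum_inner_covDvg τ φ g z₀ (r + 1) hφ0'
  -- (5) Young, bond by bond
  have h5 : ∑ y ∈ box z₀ (r + 1), ∑ μ, ⟪Dφ y μ, g y μ⟫_ℝ ≤
      (1 / 2) * E + (1 / 2) * m ^ 2 * ∑ y ∈ box z₀ (r + 1), ∑ μ : Fin d, (if Dφ y μ ≠ 0 then (1 : ℝ) else 0) := by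
    rw [hE, Finset.mul_sum, Finset.mul_sum, ← Finset.sum_add_distrib]
    refine Finset.sum_le_sum fun y hy => ?_
    rw [Finset.mul_sum, Finset.mul_sum, ← Finset.sum_add_distrib]
    exact Finset.sum_le_sum fun μ _ => inner_le_half_normSq_add _ _ (hg y hy μ)
  -- (6) counting the bonds: each carries an end in `A`
  have h6 : ∑ y ∈ box z₀ (r + 1), ∑ μ : Fin d, (if Dφ y μ ≠ 0 then (1 : ℝ) else 0) ≤ 2 * d * (A.card : ℝ) := by
    have hbond : ∀ (y : Zd d) (μ : Fin d), (if Dφ y μ ≠ 0 then (1 : ℝ) else 0) ≤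
        (if y ∈ A then (1 : ℝ) else 0) + (if y + unitVec μ ∈ A then (1 : ℝ) else 0) := by
      intro y μ
      by_cases hf : Dφ y μ ≠ 0
      · rw [if_pos hf]
        have : φ y ≠ 0 ∨ φ (y + unitVec μ) ≠ 0 := by
          by_contra hboth
          push Not at hboth
          exact hf (by simp only [hDφ, hboth.1, hboth.2, map_zero, sub_zero])
        rcases this with h | h
        · rw [if_pos (hφA _ h)]; split_ifs <;> norm_num
        · rw [if_pos (hφA _ h)]; split_ifs <;> norm_num
      · rw [if_neg hf]; split_ifs <;> norm_num
    have hcount1 : ∑ y ∈ box z₀ (r + 1), (if y ∈ A then (1 : ℝ) else 0) ≤ A.card := by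
      rw [Finset.sum_boole]
      have : ((box z₀ (r + 1)).filter fun y => y ∈ A).card ≤ A.card :=
        Finset.card_le_card fun y hy => (Finset.mem_filter.mp hy).2
      exact_mod_cast this
    have hcount2 : ∀ μ : Fin d, ∑ y ∈ box z₀ (r + 1), (if y + unitVec μ ∈ A then (1 : ℝ) else 0) ≤ A.card := by
      intro μ
      rw [Finset.sum_boole]
      have : ((box z₀ (r + 1)).filter fun y => y + unitVec μ ∈ A).card ≤ A.card :=
        Finset.card_le_card_of_injOn (fun y => y + unitVec μ)
          (fun y hy => (Finset.mem_filter.mp (Finset.mem_coe.mp hy)).2)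
          (fun y _ y' _ h => add_right_cancel h)
      exact_mod_cast this
    calc ∑ y ∈ box z₀ (r + 1), ∑ μ : Fin d, (if Dφ y μ ≠ 0 then (1 : ℝ) else 0)
        ≤ ∑ y ∈ box z₀ (r + 1), ∑ μ : Fin d, ((if y ∈ A then (1 : ℝ) else 0) + (if y + unitVec μ ∈ A then (1 : ℝ) else 0)) :=
          Finset.sum_le_sum fun y _ => Finset.sum_le_sum fun μ _ => hbond y μ
      _ = ∑ μ : Fin d, ((∑ y ∈ box z₀ (r + 1), (if y ∈ A then (1 : ℝ) else 0)) +
            ∑ y ∈ box z₀ (r + 1), (if y + unitVec μ ∈ A then (1 : ℝ) else 0)) := by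
          rw [Finset.sum_comm]
          exact Finset.sum_congr rfl fun μ _ => Finset.sum_add_distrib
      _ ≤ ∑ μ : Fin d, ((A.card : ℝ) + A.card) := Finset.sum_le_sum fun μ _ => add_le_add hcount1 (hcount2 μ)
      _ = 2 * d * (A.card : ℝ) := by
          rw [Finset.sum_const, Finset.card_univ, Fintype.card_fin, nsmul_eq_mul]; ring
  -- assemble: `E ≤ ½E + ½m²·(2d·#A)`
  have hE' : E ≤ (1 / 2) * E + (1 / 2) * m ^ 2 * (2 * d * (A.card : ℝ)) := by
    calc E ≤ ∑ y ∈ box z₀ (r + 1), ∑ μ, ⟪Dφ y μ, g y μ⟫_ℝ := by rw [← h4, ← h3, ← h2]; linarith [h1, hmass]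
      _ ≤ (1 / 2) * E + (1 / 2) * m ^ 2 * ∑ y ∈ box z₀ (r + 1), ∑ μ : Fin d, (if Dφ y μ ≠ 0 then (1 : ℝ) else 0) := h5
      _ ≤ (1 / 2) * E + (1 / 2) * m ^ 2 * (2 * d * (A.card : ℝ)) := by
          have : 0 ≤ (1 / 2) * m ^ 2 := by positivity
          nlinarith [h6]
  nlinarith [hE', h0]

/-! ## §3 ★★ The sup bound for the covariant Dirichlet corrector -/

/-- ★★ **THE `L^∞` BOUND FOR THE COVARIANT BOX DIRICHLET CORRECTOR WITH DIVERGENCE-FORM DATA.**  Any connection by linear isometries `τ`; `d ≥ 1`, `r ≥ 0`,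
`m ≥ 0`, `κ ≥ 0`; if `w = 0` off `Q_r(z₀)`, `(Σ_μ D*_μD_μ + κ)w = Σ_μ D*_μ g_μ` on `Q_r(z₀)` and `‖g_μ(y)‖ ≤ m` for `y ∈ Q_{r+1}(z₀)`, then
`‖w(y)‖ ≤ 64·2^d·d·m·(2r+1)` for every `y ∈ ℤ^d` — the flat constant of ✓`abs_le_of_dirichlet`, NO smallness of the connection, the mass term only helps
(§2 + ✓`le_of_energy`; the operator letters are ★w5-19936 g11's COV-DIRICHLET VERBATIM). [folklore]
[cite: Giaquinta1984, Ch. III §2 p.78; Balaban1984PropagatorsII, (1.9) p.226] -/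
theorem norm_le_of_covDirichlet (hd : 1 ≤ d) (τ : Fin d → Zd d → (V ≃ₗᵢ[ℝ] V)) {κ : ℝ} (hκ : 0 ≤ κ) {w : Zd d → V} {z₀ : Zd d} {r : ℤ}
    (hr : 0 ≤ r) (g : Zd d → Fin d → V) {m : ℝ} (hm : 0 ≤ m) (hw0 : ∀ y ∉ box z₀ r, w y = 0)
    (hw : ∀ y ∈ box z₀ r, (∑ μ, ((w y + w y) - (τ μ (y - unitVec μ)).symm (w (y - unitVec μ)) - τ μ y (w (y + unitVec μ)))) + κ • w y =
      ∑ μ, ((τ μ (y - unitVec μ)).symm (g (y - unitVec μ) μ) - g y μ))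
    (hg : ∀ y ∈ box z₀ (r + 1), ∀ μ, ‖g y μ‖ ≤ m) (y : Zd d) :
    ‖w y‖ ≤ 64 * (2 : ℝ) ^ d * d * m * (2 * (r : ℝ) + 1) :=
  le_of_energy hd hr hm (z := fun x => ‖w x‖) (fun x hx => by simp only [hw0 x hx, norm_zero])
    (fun k hk => cov_truncation_energy_le τ hκ g hk hw0 hw hg) y

end Summit.QuantumFields.YangMills.Theorems.PoincareLipschitzCovariantDirichletSup

end
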